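import Mathlib.Analysis.Real.Sqrt
import Mathlib.Algebra.Field.GeomSum
import Mathlib.Tactic
import HarnessLib

/-!
# S2β · the (D-stage) REL-TEL road — THE (H♭♭) FEEDERS DOOR, PART A (pure `ℝ` bookkeeping): the explicit feedback weights `W j u`, the W-sum identity,
# the smallness row `Σ_{u≤j}(√L)^{j−u}·W j u ≤ (C∕√L)·G_j(qd) + (C∕L)·G_j(qU) + η_j`, the level lemma, and ★`G_le_of_bkgPriced`: a BACKGROUND-priced
# coefficient `x_u ≤ κ·L^{2u}·(L⁻¹)^{2N}` has geometric amplification `G(x) = Σ_{j<N}Σ_{u≤j}L^{j−u}x_u ≤ κL∕((L−1)(L²−1))`, UNIFORMLY IN THE DEPTH `N`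

Cell `ym3-torus` (rung R3 = continuum `SU(2)` Yang–Mills on T³ — NOT d = 4, NOT infinite volume, NOT a mass gap, NOT Clay).  Width seat «width 12» `ym3-torus-px12`
(gen 24), FREE px helper on crux `stmt-QuantumFields-20520`; `--kind proof --supports … --as helper`, count-neutral, DEFINITION-FREE (0 `def`∕`instance`∕`notation`∕`sorry`).

WHAT IT IS FOR.  Part B (`…RelFlapOfFeeders`) turns the five per-level feeders of the two-tower letter (H♭♭) of ✓p824471 `dockRel_of_towers_feedback` —
F1-rel (px10 FILE 11 ✓`relKeyLemma_torus_of_step`, ABSTRACT junk `η^A_s` with the menu `η^A_s ≤ qd_s·B_s + qU_s·B_{s+1}`), F2-rel (px21 C4 shape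
`flap_j ≤ a₁A_j + a₂A^V_j + η_jB_j + ζ_jB^V_j`), (F3)-rel (`A^V_j ≤ C_F·A_{j+1} + φ_j·Λ_{j+1}`), (R1) chord (`B^V_j ≤ √L·Λ_{j+1}`), (L♭) (`Λ_{j+1} ≤ (1+r_j)B_{j+1}`) —
into that letter with `e_j = (a₂C_FX₁qU_j + a₂φ_j(1+r_j))∕√L + ζ_j(1+r_j)`, `C = X₁(a₁ + a₂C_F√L)` and the explicit weights
`W j u = Σ_{s<j}[u=s]a₁X₁(√L)^{j−1−s}qd_s + Σ_{s<j}[u=s+1]a₁X₁(√L)^{j−1−s}qU_s + Σ_{s≤j}[u=s]a₂C_FX₁(√L)^{j−s}qd_s + Σ_{s<j}[u=s+1]a₂C_FX₁(√L)^{j−s}qU_s + [u=j]η_j`.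
This part is the index algebra over `ℝ`: `sum_range_ite_mul`, `sum_range_sum_ite_self_mul`, `sum_range_sum_ite_succ_mul`, the `√L`-power identities,
★`sum_W_mul_eq`, `W_nonneg`, ★`sum_sqrtL_pow_mul_W_le` (the smallness row), ★`G_le_of_bkgPriced`, ★★`flap_le_of_feeders_level`.
‼ ADMISSIBILITY (UV3-NODE §84.8, bus 14:20Z).  The W-smallness `e^E·Σ_jΣ_{u≤j}(√L)^{j−u}W j u ≤ ½` of ✓p824415∕✓p824471 reads
`e^E·((C∕√L)·G(qd) + (C∕L)·G(qU) + Σ_jη_j) ≤ ½`; `G` is N-free for BACKGROUND-priced coefficients (✓p825096: `θ₀,u = 2C₁θ_J·L^{2u}(L⁻¹)^{2N}`) by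
★`G_le_of_bkgPriced`, but `~(√L)^N` for a coefficient priced by a RELATIVE sup or by the history size (only `√L`-geometric) — so the additive `1.1·10⁷·β²` of
✓`relOneLevelStep_bkg` (β ≥ the coarse-bond relative deviation) is NOT admissible; the cure is the second-order chord distortion ✓p822698
`norm_sub_le_mul_norm_exp_imQuat_sub`, which makes the quadratic-relative loss multiplicative (→ `ε_t`, inside `X₁`).
HONEST SCOPE.  Finite sums over `ℝ`; nothing of Bałaban's analysis is asserted; (H♭♭)'s feeders, (D-ax)∕(D♮), (F♮), GAP♯∘ (`stub_uniformFibreGapOrbit`), S2β, the five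
registered stubs (0∕5), crux 20520 and `YM3TorusSU2` are NOT proved; no registered stub is closed; the Yang–Mills mass gap is NOT proved.
References: T. Bałaban, CMP **99** (1985) 75–102 [Balaban1985RegularSpaces] ((1.29) p.81, Lemma 1 p.79); CMP **102** (1985) 277–309 [Balaban1985Variational] ((4) p.278).
-/

set_option autoImplicit false

noncomputable section

namespace Summit.QuantumFields.YangMills.Theorems.FluctuationComparisonRegPrIntLS2BetaRelFlapOfFeedersAlgebra

open Finset

/-! ## §1 Pure bookkeeping over `ℝ` -/

variable {L : ℝ}

/-- A Kronecker sum over an initial segment: `Σ_{u<n} (if u = s then c else 0)·f u = c·f s` for `s < n`. [cite: Balaban1985RegularSpaces, (1.29) p.81] -/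
theorem sum_range_ite_mul (n s : ℕ) (hs : s < n) (c : ℝ) (f : ℕ → ℝ) :
    ∑ u ∈ range n, (if u = s then c else 0) * f u = c * f s := by
  simp_rw [ite_mul, zero_mul]
  rw [Finset.sum_ite_eq' (range n) s (fun u => c * f u), if_pos (mem_range.2 hs)]

/-- Diagonal Kronecker double sum: `Σ_{u<m}(Σ_{s<n}[u=s]·x s)·f u = Σ_{s<n} x s·f s` when `n ≤ m`. [cite: Balaban1985RegularSpaces, (1.29) p.81] -/
theorem sum_range_sum_ite_self_mul (m n : ℕ) (hnm : n ≤ m) (x f : ℕ → ℝ) :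
    ∑ u ∈ range m, (∑ s ∈ range n, if u = s then x s else 0) * f u = ∑ s ∈ range n, x s * f s := by
  simp_rw [Finset.sum_mul]
  rw [Finset.sum_comm]
  exact Finset.sum_congr rfl fun s hs => sum_range_ite_mul m s (lt_of_lt_of_le (mem_range.1 hs) hnm) (x s) f

/-- Shifted Kronecker double sum: `Σ_{u<m}(Σ_{s<n}[u=s+1]·x s)·f u = Σ_{s<n} x s·f (s+1)` when `n < m`. [cite: Balaban1985RegularSpaces, (1.29) p.81] -/
theorem sum_range_sum_ite_succ_mul (m n : ℕ) (hnm : n < m) (x f : ℕ → ℝ) :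
    ∑ u ∈ range m, (∑ s ∈ range n, if u = s + 1 then x s else 0) * f u = ∑ s ∈ range n, x s * f (s + 1) := by
  simp_rw [Finset.sum_mul]
  rw [Finset.sum_comm]
  exact Finset.sum_congr rfl fun s hs => sum_range_ite_mul m (s + 1) (by have := mem_range.1 hs; omega) (x s) f

/-- `(√L)^m·(√L)^m = L^m` (`0 ≤ L`). [cite: Balaban1985RegularSpaces, (1.29) p.81] -/
theorem sqrt_pow_mul_self (hL : 0 ≤ L) (m : ℕ) : Real.sqrt L ^ m * Real.sqrt L ^ m = L ^ m := by
  rw [← mul_pow, Real.mul_self_sqrt hL]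

/-- `(√L)^{j−1−s}·(√L)^{j−s} = L^{j−s}∕√L` for `s < j` (`0 < L`). [cite: Balaban1985RegularSpaces, (1.29) p.81] -/
theorem sqrt_pow_pred_mul (hL : 0 < L) {j s : ℕ} (hs : s < j) :
    Real.sqrt L ^ (j - 1 - s) * Real.sqrt L ^ (j - s) = L ^ (j - s) / Real.sqrt L := by
  have hsq : 0 < Real.sqrt L := Real.sqrt_pos.2 hL
  obtain ⟨m, hm⟩ : ∃ m, j - s = m + 1 := ⟨j - 1 - s, by omega⟩
  have hm' : j - 1 - s = m := by omega
  rw [hm, hm', eq_div_iff hsq.ne']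
  calc Real.sqrt L ^ m * Real.sqrt L ^ (m + 1) * Real.sqrt L
        = (Real.sqrt L ^ m * Real.sqrt L ^ m) * (Real.sqrt L * Real.sqrt L) := by ring
    _ = L ^ (m + 1) := by rw [sqrt_pow_mul_self hL.le, Real.mul_self_sqrt hL.le, pow_succ]

/-- `(√L)^{j−1−s}·(√L)^{j−(s+1)} = L^{j−s}∕L` for `s < j` (`0 < L`). [cite: Balaban1985RegularSpaces, (1.29) p.81] -/
theorem sqrt_pow_pred_mul_pred (hL : 0 < L) {j s : ℕ} (hs : s < j) :
    Real.sqrt L ^ (j - 1 - s) * Real.sqrt L ^ (j - (s + 1)) = L ^ (j - s) / L := by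
  obtain ⟨m, hm⟩ : ∃ m, j - s = m + 1 := ⟨j - 1 - s, by omega⟩
  have h1 : j - 1 - s = m := by omega
  have h2 : j - (s + 1) = m := by omega
  rw [h1, h2, hm, sqrt_pow_mul_self hL.le, pow_succ, mul_div_cancel_right₀ _ hL.ne']

/-- `(√L)^{j−s}·(√L)^{j−(s+1)} = L^{j−s}∕√L` for `s < j` (`0 < L`). [cite: Balaban1985RegularSpaces, (1.29) p.81] -/
theorem sqrt_pow_mul_pred (hL : 0 < L) {j s : ℕ} (hs : s < j) :
    Real.sqrt L ^ (j - s) * Real.sqrt L ^ (j - (s + 1)) = L ^ (j - s) / Real.sqrt L := by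
  rw [mul_comm, show j - (s + 1) = j - 1 - s from by omega]
  exact sqrt_pow_pred_mul hL hs

/-- ★ **THE W-SUM IDENTITY** for the explicit feedback weights
`W j u = Σ_{s<j}[u=s]·a₁X₁(√L)^{j−1−s}qd_s + Σ_{s<j}[u=s+1]·a₁X₁(√L)^{j−1−s}qU_s + Σ_{s≤j}[u=s]·a₂C_FX₁(√L)^{j−s}qd_s + Σ_{s<j}[u=s+1]·a₂C_FX₁(√L)^{j−s}qU_s + [u=j]·η_j`:
`Σ_{u≤j} W j u·f u` is the same expression with the Kroneckers evaluated. [cite: Balaban1985RegularSpaces, (1.29) p.81] -/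
theorem sum_W_mul_eq (a₁ a₂ C_F X₁ : ℝ) (qd qU η f : ℕ → ℝ) (j : ℕ) :
    ∑ u ∈ range (j + 1),
        ((∑ s ∈ range j, if u = s then a₁ * X₁ * Real.sqrt L ^ (j - 1 - s) * qd s else 0) +
          (∑ s ∈ range j, if u = s + 1 then a₁ * X₁ * Real.sqrt L ^ (j - 1 - s) * qU s else 0) +
          (∑ s ∈ range (j + 1), if u = s then a₂ * C_F * X₁ * Real.sqrt L ^ (j - s) * qd s else 0) +
          (∑ s ∈ range j, if u = s + 1 then a₂ * C_F * X₁ * Real.sqrt L ^ (j - s) * qU s else 0) +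
          (if u = j then η j else 0)) * f u =
      (∑ s ∈ range j, a₁ * X₁ * Real.sqrt L ^ (j - 1 - s) * qd s * f s) +
        (∑ s ∈ range j, a₁ * X₁ * Real.sqrt L ^ (j - 1 - s) * qU s * f (s + 1)) +
        (∑ s ∈ range (j + 1), a₂ * C_F * X₁ * Real.sqrt L ^ (j - s) * qd s * f s) +
        (∑ s ∈ range j, a₂ * C_F * X₁ * Real.sqrt L ^ (j - s) * qU s * f (s + 1)) +
        η j * f j := by
  simp only [add_mul, Finset.sum_add_distrib]
  rw [sum_range_sum_ite_self_mul (j + 1) j (Nat.le_succ j), sum_range_sum_ite_succ_mul (j + 1) j (Nat.lt_succ_self j),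
    sum_range_sum_ite_self_mul (j + 1) (j + 1) le_rfl, sum_range_sum_ite_succ_mul (j + 1) j (Nat.lt_succ_self j),
    sum_range_ite_mul (j + 1) j (Nat.lt_succ_self j)]

/-- The explicit feedback weights are nonnegative. [cite: Balaban1985RegularSpaces, (1.29) p.81] -/
theorem W_nonneg {a₁ a₂ C_F X₁ : ℝ} (ha₁ : 0 ≤ a₁) (ha₂ : 0 ≤ a₂) (hCF : 0 ≤ C_F) (hX₁ : 0 ≤ X₁)
    (qd qU η : ℕ → ℝ) (hqd : ∀ s, 0 ≤ qd s) (hqU : ∀ s, 0 ≤ qU s) (hη : ∀ s, 0 ≤ η s) (j u : ℕ) :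
    0 ≤ (∑ s ∈ range j, if u = s then a₁ * X₁ * Real.sqrt L ^ (j - 1 - s) * qd s else 0) +
          (∑ s ∈ range j, if u = s + 1 then a₁ * X₁ * Real.sqrt L ^ (j - 1 - s) * qU s else 0) +
          (∑ s ∈ range (j + 1), if u = s then a₂ * C_F * X₁ * Real.sqrt L ^ (j - s) * qd s else 0) +
          (∑ s ∈ range j, if u = s + 1 then a₂ * C_F * X₁ * Real.sqrt L ^ (j - s) * qU s else 0) +
          (if u = j then η j else 0) := by
  have hsq : 0 ≤ Real.sqrt L := Real.sqrt_nonneg L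
  have hA : 0 ≤ a₁ * X₁ := mul_nonneg ha₁ hX₁
  have hB : 0 ≤ a₂ * C_F * X₁ := mul_nonneg (mul_nonneg ha₂ hCF) hX₁
  have h1 : ∀ s, 0 ≤ a₁ * X₁ * Real.sqrt L ^ (j - 1 - s) * qd s := fun s => mul_nonneg (mul_nonneg hA (pow_nonneg hsq _)) (hqd s)
  have h2 : ∀ s, 0 ≤ a₁ * X₁ * Real.sqrt L ^ (j - 1 - s) * qU s := fun s => mul_nonneg (mul_nonneg hA (pow_nonneg hsq _)) (hqU s)
  have h3 : ∀ s, 0 ≤ a₂ * C_F * X₁ * Real.sqrt L ^ (j - s) * qd s := fun s => mul_nonneg (mul_nonneg hB (pow_nonneg hsq _)) (hqd s)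
  have h4 : ∀ s, 0 ≤ a₂ * C_F * X₁ * Real.sqrt L ^ (j - s) * qU s := fun s => mul_nonneg (mul_nonneg hB (pow_nonneg hsq _)) (hqU s)
  refine add_nonneg (add_nonneg (add_nonneg (add_nonneg ?_ ?_) ?_) ?_) ?_
  · exact Finset.sum_nonneg fun s _ => by split_ifs <;> [exact h1 s; exact le_rfl]
  · exact Finset.sum_nonneg fun s _ => by split_ifs <;> [exact h2 s; exact le_rfl]
  · exact Finset.sum_nonneg fun s _ => by split_ifs <;> [exact h3 s; exact le_rfl]
  · exact Finset.sum_nonneg fun s _ => by split_ifs <;> [exact h4 s; exact le_rfl]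
  · split_ifs <;> [exact hη j; exact le_rfl]

/-- ★ **THE SMALLNESS ROW, ONE LEVEL**: `Σ_{u≤j}(√L)^{j−u}·W j u ≤ (a₁X₁∕√L + a₂C_FX₁)·Σ_{u≤j}L^{j−u}qd_u + (a₁X₁∕L + a₂C_FX₁∕√L)·Σ_{u≤j}L^{j−u}qU_u + η_j`
(`1 ≤ L`... `0 < L`; the two coefficients are `C∕√L` and `C∕L`, `C = X₁(a₁ + a₂C_F√L)`). [cite: Balaban1985RegularSpaces, (1.29) p.81] -/
theorem sum_sqrtL_pow_mul_W_le (hL : 0 < L) {a₁ a₂ C_F X₁ : ℝ} (ha₁ : 0 ≤ a₁) (ha₂ : 0 ≤ a₂) (hCF : 0 ≤ C_F) (hX₁ : 0 ≤ X₁)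
    (qd qU η : ℕ → ℝ) (hqd : ∀ s, 0 ≤ qd s) (hqU : ∀ s, 0 ≤ qU s) (j : ℕ) :
    ∑ u ∈ range (j + 1), Real.sqrt L ^ (j - u) *
        ((∑ s ∈ range j, if u = s then a₁ * X₁ * Real.sqrt L ^ (j - 1 - s) * qd s else 0) +
          (∑ s ∈ range j, if u = s + 1 then a₁ * X₁ * Real.sqrt L ^ (j - 1 - s) * qU s else 0) +
          (∑ s ∈ range (j + 1), if u = s then a₂ * C_F * X₁ * Real.sqrt L ^ (j - s) * qd s else 0) +
          (∑ s ∈ range j, if u = s + 1 then a₂ * C_F * X₁ * Real.sqrt L ^ (j - s) * qU s else 0) +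
          (if u = j then η j else 0)) ≤
      (a₁ * X₁ / Real.sqrt L + a₂ * C_F * X₁) * ∑ u ∈ range (j + 1), L ^ (j - u) * qd u +
        (a₁ * X₁ / L + a₂ * C_F * X₁ / Real.sqrt L) * ∑ u ∈ range (j + 1), L ^ (j - u) * qU u + η j := by
  have hsq : 0 < Real.sqrt L := Real.sqrt_pos.2 hL
  simp_rw [mul_comm (Real.sqrt L ^ (j - _)) _]
  rw [sum_W_mul_eq a₁ a₂ C_F X₁ qd qU η (fun u => Real.sqrt L ^ (j - u)) j]
  -- evaluate the `√L`-power products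
  have e1 : ∑ s ∈ range j, a₁ * X₁ * Real.sqrt L ^ (j - 1 - s) * qd s * Real.sqrt L ^ (j - s) =
      a₁ * X₁ / Real.sqrt L * ∑ s ∈ range j, L ^ (j - s) * qd s := by
    rw [Finset.mul_sum]
    refine Finset.sum_congr rfl fun s hs => ?_
    have := sqrt_pow_pred_mul hL (mem_range.1 hs)
    calc a₁ * X₁ * Real.sqrt L ^ (j - 1 - s) * qd s * Real.sqrt L ^ (j - s)
          = a₁ * X₁ * qd s * (Real.sqrt L ^ (j - 1 - s) * Real.sqrt L ^ (j - s)) := by ring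
      _ = a₁ * X₁ / Real.sqrt L * (L ^ (j - s) * qd s) := by rw [this]; field_simp
  have e2 : ∑ s ∈ range j, a₁ * X₁ * Real.sqrt L ^ (j - 1 - s) * qU s * Real.sqrt L ^ (j - (s + 1)) =
      a₁ * X₁ / L * ∑ s ∈ range j, L ^ (j - s) * qU s := by
    rw [Finset.mul_sum]
    refine Finset.sum_congr rfl fun s hs => ?_
    have := sqrt_pow_pred_mul_pred hL (mem_range.1 hs)
    calc a₁ * X₁ * Real.sqrt L ^ (j - 1 - s) * qU s * Real.sqrt L ^ (j - (s + 1))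
          = a₁ * X₁ * qU s * (Real.sqrt L ^ (j - 1 - s) * Real.sqrt L ^ (j - (s + 1))) := by ring
      _ = a₁ * X₁ / L * (L ^ (j - s) * qU s) := by rw [this]; field_simp
  have e3 : ∑ s ∈ range (j + 1), a₂ * C_F * X₁ * Real.sqrt L ^ (j - s) * qd s * Real.sqrt L ^ (j - s) =
      a₂ * C_F * X₁ * ∑ s ∈ range (j + 1), L ^ (j - s) * qd s := by
    rw [Finset.mul_sum]
    refine Finset.sum_congr rfl fun s _ => ?_
    have := sqrt_pow_mul_self hL.le (j - s)
    calc a₂ * C_F * X₁ * Real.sqrt L ^ (j - s) * qd s * Real.sqrt L ^ (j - s)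
          = a₂ * C_F * X₁ * qd s * (Real.sqrt L ^ (j - s) * Real.sqrt L ^ (j - s)) := by ring
      _ = a₂ * C_F * X₁ * (L ^ (j - s) * qd s) := by rw [this]; ring
  have e4 : ∑ s ∈ range j, a₂ * C_F * X₁ * Real.sqrt L ^ (j - s) * qU s * Real.sqrt L ^ (j - (s + 1)) =
      a₂ * C_F * X₁ / Real.sqrt L * ∑ s ∈ range j, L ^ (j - s) * qU s := by
    rw [Finset.mul_sum]
    refine Finset.sum_congr rfl fun s hs => ?_
    have := sqrt_pow_mul_pred hL (mem_range.1 hs)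
    calc a₂ * C_F * X₁ * Real.sqrt L ^ (j - s) * qU s * Real.sqrt L ^ (j - (s + 1))
          = a₂ * C_F * X₁ * qU s * (Real.sqrt L ^ (j - s) * Real.sqrt L ^ (j - (s + 1))) := by ring
      _ = a₂ * C_F * X₁ / Real.sqrt L * (L ^ (j - s) * qU s) := by rw [this]; field_simp
  rw [e1, e2, e3, e4, Nat.sub_self, pow_zero, mul_one]
  -- extend the two short sums by their (nonnegative) last term
  have x1 : ∑ s ∈ range j, L ^ (j - s) * qd s ≤ ∑ s ∈ range (j + 1), L ^ (j - s) * qd s := by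
    rw [Finset.sum_range_succ]; exact le_add_of_nonneg_right (mul_nonneg (pow_nonneg hL.le _) (hqd j))
  have x2 : ∑ s ∈ range j, L ^ (j - s) * qU s ≤ ∑ s ∈ range (j + 1), L ^ (j - s) * qU s := by
    rw [Finset.sum_range_succ]; exact le_add_of_nonneg_right (mul_nonneg (pow_nonneg hL.le _) (hqU j))
  have c1 : 0 ≤ a₁ * X₁ / Real.sqrt L := by positivity
  have c2 : 0 ≤ a₁ * X₁ / L := by positivity
  have c4 : 0 ≤ a₂ * C_F * X₁ / Real.sqrt L := by positivity
  nlinarith [mul_le_mul_of_nonneg_left x1 c1, mul_le_mul_of_nonneg_left x2 c2, mul_le_mul_of_nonneg_left x2 c4]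

/-- ★ **BACKGROUND-PRICED COEFFICIENTS ARE ADMISSIBLE, UNIFORMLY IN THE DEPTH**: if `0 ≤ x_u ≤ κ·L^{2u}·(L⁻¹)^{2N}` for `u < N` (`1 < L`, `0 ≤ κ`), then the
geometric amplification functional satisfies `Σ_{j<N}Σ_{u≤j} L^{j−u}·x_u ≤ κ·L∕((L−1)(L²−1))`. [cite: Balaban1985Variational, (4) p.278] -/
theorem G_le_of_bkgPriced (hL : 1 < L) {N : ℕ} {κ : ℝ} (hκ : 0 ≤ κ) (x : ℕ → ℝ)
    (hx : ∀ u, u < N → x u ≤ κ * L ^ (2 * u) * (L⁻¹) ^ (2 * N)) :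
    ∑ j ∈ range N, ∑ u ∈ range (j + 1), L ^ (j - u) * x u ≤ κ * L / ((L - 1) * (L ^ 2 - 1)) := by
  have hL0 : 0 < L := by linarith
  have hL1 : 0 < L - 1 := by linarith
  have hL2 : 0 < L ^ 2 - 1 := by nlinarith
  have hgeo1 : ∀ n : ℕ, ∑ u ∈ range n, L ^ u ≤ L ^ n / (L - 1) := by
    intro n
    rw [geom_sum_eq hL.ne' n]
    exact div_le_div_of_nonneg_right (by linarith) hL1.le
  have hgeo2 : ∑ j ∈ range N, (L ^ 2) ^ j ≤ (L ^ 2) ^ N / (L ^ 2 - 1) := by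
    rw [geom_sum_eq (by nlinarith : L ^ 2 ≠ 1) N]
    exact div_le_div_of_nonneg_right (by linarith) hL2.le
  -- one level
  have hlev : ∀ j, j < N → ∑ u ∈ range (j + 1), L ^ (j - u) * x u ≤ κ * (L⁻¹) ^ (2 * N) * (L * (L ^ 2) ^ j) / (L - 1) := by
    intro j hj
    calc ∑ u ∈ range (j + 1), L ^ (j - u) * x u
          ≤ ∑ u ∈ range (j + 1), L ^ (j - u) * (κ * L ^ (2 * u) * (L⁻¹) ^ (2 * N)) :=
            Finset.sum_le_sum fun u hu => mul_le_mul_of_nonneg_left (hx u (by have := mem_range.1 hu; omega)) (pow_nonneg hL0.le _)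
      _ = κ * (L⁻¹) ^ (2 * N) * (L ^ j * ∑ u ∈ range (j + 1), L ^ u) := by
            rw [Finset.mul_sum, Finset.mul_sum]
            refine Finset.sum_congr rfl fun u hu => ?_
            have hu' : j - u + 2 * u = j + u := by have := mem_range.1 hu; omega
            calc L ^ (j - u) * (κ * L ^ (2 * u) * (L⁻¹) ^ (2 * N)) = κ * (L⁻¹) ^ (2 * N) * (L ^ (j - u) * L ^ (2 * u)) := by ring
              _ = κ * (L⁻¹) ^ (2 * N) * (L ^ j * L ^ u) := by rw [← pow_add, hu', pow_add]
      _ ≤ κ * (L⁻¹) ^ (2 * N) * (L ^ j * (L ^ (j + 1) / (L - 1))) := by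
            have : 0 ≤ κ * (L⁻¹) ^ (2 * N) := by positivity
            exact mul_le_mul_of_nonneg_left (mul_le_mul_of_nonneg_left (hgeo1 (j + 1)) (pow_nonneg hL0.le _)) this
      _ = κ * (L⁻¹) ^ (2 * N) * (L * (L ^ 2) ^ j) / (L - 1) := by rw [← pow_mul, pow_succ]; ring
  calc ∑ j ∈ range N, ∑ u ∈ range (j + 1), L ^ (j - u) * x u
        ≤ ∑ j ∈ range N, κ * (L⁻¹) ^ (2 * N) * (L * (L ^ 2) ^ j) / (L - 1) := Finset.sum_le_sum fun j hj => hlev j (mem_range.1 hj)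
    _ = κ * (L⁻¹) ^ (2 * N) * L / (L - 1) * ∑ j ∈ range N, (L ^ 2) ^ j := by
          rw [Finset.mul_sum]; exact Finset.sum_congr rfl fun j _ => by ring
    _ ≤ κ * (L⁻¹) ^ (2 * N) * L / (L - 1) * ((L ^ 2) ^ N / (L ^ 2 - 1)) :=
          mul_le_mul_of_nonneg_left hgeo2 (by positivity)
    _ = κ * L / ((L - 1) * (L ^ 2 - 1)) * ((L⁻¹) ^ (2 * N) * (L ^ 2) ^ N) := by
          rw [div_eq_mul_inv, div_eq_mul_inv, div_eq_mul_inv, mul_inv]; ring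
    _ = κ * L / ((L - 1) * (L ^ 2 - 1)) := by
          have hLN : (L⁻¹) ^ (2 * N) * (L ^ 2) ^ N = 1 := by
            rw [← pow_mul, inv_pow, inv_mul_cancel₀ (pow_ne_zero _ hL0.ne')]
          rw [hLN, mul_one]


/-- ★★ **THE LEVEL LEMMA** (pure): from F1-rel at `t = j, j+1` (abstract junk with the menu `η^A_s ≤ qd_s·B_s + qU_s·B_{s+1}`), F2-rel, (F3)-rel, (R1) and (L♭) at
level `j`, the relative flap obeys `Fl_j ≤ √L·e_j·B_{j+1} + (C·(√L)^j·S + Σ_{u≤j} W j u·B_u)` with `e_j = (a₂C_FX₁qU_j + a₂φ_j(1+r_j))∕√L + ζ_j(1+r_j)`,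
`C = X₁(a₁ + a₂C_F√L)` and the explicit `W` of ✓`sum_W_mul_eq`. [cite: Balaban1985RegularSpaces, (1.29) p.81, Lemma 1 p.79] -/
theorem flap_le_of_feeders_level {L : ℝ} (hL : 0 < L) {X₁ a₁ a₂ C_F S : ℝ} (ha₁ : 0 ≤ a₁) (ha₂ : 0 ≤ a₂) (hCF : 0 ≤ C_F) (hX₁ : 0 ≤ X₁)
    (B A Av Bv Λ Fl ηA r φ η ζ qd qU : ℕ → ℝ) (hφ : ∀ j, 0 ≤ φ j) (hζ : ∀ j, 0 ≤ ζ j) {j : ℕ}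
    (hΛ : Λ (j + 1) ≤ (1 + r j) * B (j + 1)) (hBv : Bv j ≤ Real.sqrt L * Λ (j + 1))
    (hAj : A j ≤ X₁ * (Real.sqrt L ^ j * S + ∑ s ∈ range j, Real.sqrt L ^ (j - 1 - s) * ηA s))
    (hAj1 : A (j + 1) ≤ X₁ * (Real.sqrt L ^ (j + 1) * S + ∑ s ∈ range (j + 1), Real.sqrt L ^ (j - s) * ηA s))
    (hη : ∀ s, s ≤ j → ηA s ≤ qd s * B s + qU s * B (s + 1))
    (hF2 : Fl j ≤ a₁ * A j + a₂ * Av j + η j * B j + ζ j * Bv j) (hF3 : Av j ≤ C_F * A (j + 1) + φ j * Λ (j + 1)) :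
    Fl j ≤ Real.sqrt L * ((a₂ * C_F * X₁ * qU j + a₂ * φ j * (1 + r j)) / Real.sqrt L + ζ j * (1 + r j)) * B (j + 1) +
      (X₁ * (a₁ + a₂ * C_F * Real.sqrt L) * Real.sqrt L ^ j * S +
        ∑ u ∈ range (j + 1),
          ((∑ s ∈ range j, if u = s then a₁ * X₁ * Real.sqrt L ^ (j - 1 - s) * qd s else 0) +
            (∑ s ∈ range j, if u = s + 1 then a₁ * X₁ * Real.sqrt L ^ (j - 1 - s) * qU s else 0) +
            (∑ s ∈ range (j + 1), if u = s then a₂ * C_F * X₁ * Real.sqrt L ^ (j - s) * qd s else 0) +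
            (∑ s ∈ range j, if u = s + 1 then a₂ * C_F * X₁ * Real.sqrt L ^ (j - s) * qU s else 0) +
            (if u = j then η j else 0)) * B u) := by
  have hsq : 0 < Real.sqrt L := Real.sqrt_pos.2 hL
  rw [sum_W_mul_eq a₁ a₂ C_F X₁ qd qU η B j]
  rw [show Real.sqrt L * ((a₂ * C_F * X₁ * qU j + a₂ * φ j * (1 + r j)) / Real.sqrt L + ζ j * (1 + r j)) * B (j + 1) =
      (a₂ * C_F * X₁ * qU j + a₂ * φ j * (1 + r j) + Real.sqrt L * ζ j * (1 + r j)) * B (j + 1) from by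
    field_simp]
  -- the two junk sums, with the menu inserted
  have hS1 : ∑ s ∈ range j, Real.sqrt L ^ (j - 1 - s) * ηA s ≤ ∑ s ∈ range j, Real.sqrt L ^ (j - 1 - s) * (qd s * B s + qU s * B (s + 1)) :=
    Finset.sum_le_sum fun s hs => mul_le_mul_of_nonneg_left (hη s (mem_range.1 hs).le) (pow_nonneg hsq.le _)
  have hS2 : ∑ s ∈ range (j + 1), Real.sqrt L ^ (j - s) * ηA s ≤ ∑ s ∈ range (j + 1), Real.sqrt L ^ (j - s) * (qd s * B s + qU s * B (s + 1)) :=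
    Finset.sum_le_sum fun s hs => mul_le_mul_of_nonneg_left (hη s (Nat.lt_succ_iff.1 (mem_range.1 hs))) (pow_nonneg hsq.le _)
  have hsplit : ∑ s ∈ range (j + 1), Real.sqrt L ^ (j - s) * (qd s * B s + qU s * B (s + 1)) =
      ∑ s ∈ range j, Real.sqrt L ^ (j - s) * (qd s * B s + qU s * B (s + 1)) + (qd j * B j + qU j * B (j + 1)) := by
    rw [Finset.sum_range_succ, Nat.sub_self, pow_zero, one_mul]
  have hT12 : a₁ * X₁ * ∑ s ∈ range j, Real.sqrt L ^ (j - 1 - s) * (qd s * B s + qU s * B (s + 1)) =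
      (∑ s ∈ range j, a₁ * X₁ * Real.sqrt L ^ (j - 1 - s) * qd s * B s) +
        ∑ s ∈ range j, a₁ * X₁ * Real.sqrt L ^ (j - 1 - s) * qU s * B (s + 1) := by
    rw [Finset.mul_sum, ← Finset.sum_add_distrib]; exact Finset.sum_congr rfl fun s _ => by ring
  have hT3 : ∑ s ∈ range (j + 1), a₂ * C_F * X₁ * Real.sqrt L ^ (j - s) * qd s * B s =
      (∑ s ∈ range j, a₂ * C_F * X₁ * Real.sqrt L ^ (j - s) * qd s * B s) + a₂ * C_F * X₁ * qd j * B j := by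
    rw [Finset.sum_range_succ, Nat.sub_self, pow_zero, mul_one]
  have hT34 : a₂ * C_F * X₁ * ∑ s ∈ range j, Real.sqrt L ^ (j - s) * (qd s * B s + qU s * B (s + 1)) =
      (∑ s ∈ range j, a₂ * C_F * X₁ * Real.sqrt L ^ (j - s) * qd s * B s) +
        ∑ s ∈ range j, a₂ * C_F * X₁ * Real.sqrt L ^ (j - s) * qU s * B (s + 1) := by
    rw [Finset.mul_sum, ← Finset.sum_add_distrib]; exact Finset.sum_congr rfl fun s _ => by ring
  -- the feeder inequalities with their nonnegative coefficients
  have h1 : a₁ * A j ≤ a₁ * (X₁ * (Real.sqrt L ^ j * S + ∑ s ∈ range j, Real.sqrt L ^ (j - 1 - s) * (qd s * B s + qU s * B (s + 1)))) :=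
    mul_le_mul_of_nonneg_left (hAj.trans (mul_le_mul_of_nonneg_left (by linarith) hX₁)) ha₁
  have h2 : a₂ * C_F * A (j + 1) ≤ a₂ * C_F * (X₁ * (Real.sqrt L ^ (j + 1) * S +
      ∑ s ∈ range (j + 1), Real.sqrt L ^ (j - s) * (qd s * B s + qU s * B (s + 1)))) :=
    mul_le_mul_of_nonneg_left (hAj1.trans (mul_le_mul_of_nonneg_left (by linarith) hX₁)) (mul_nonneg ha₂ hCF)
  have h3 : a₂ * Av j ≤ a₂ * (C_F * A (j + 1) + φ j * Λ (j + 1)) := mul_le_mul_of_nonneg_left hF3 ha₂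
  have h4 : a₂ * φ j * Λ (j + 1) ≤ a₂ * φ j * ((1 + r j) * B (j + 1)) := mul_le_mul_of_nonneg_left hΛ (mul_nonneg ha₂ (hφ j))
  have h5 : ζ j * Bv j ≤ ζ j * (Real.sqrt L * Λ (j + 1)) := mul_le_mul_of_nonneg_left hBv (hζ j)
  have h6 : ζ j * Real.sqrt L * Λ (j + 1) ≤ ζ j * Real.sqrt L * ((1 + r j) * B (j + 1)) :=
    mul_le_mul_of_nonneg_left hΛ (mul_nonneg (hζ j) hsq.le)
  have hpow : Real.sqrt L ^ (j + 1) = Real.sqrt L ^ j * Real.sqrt L := pow_succ _ _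
  rw [hpow, hsplit] at h2
  nlinarith [h1, h2, h3, h4, h5, h6, hT12, hT3, hT34]

/-! ## §3 Two pure budget rows for the prefix assembly -/

/-- The e-budget row: `Σ_j ((a₂C_FX₁·qU_j + a₂φ_j(1+r_j))∕√L + ζ_j(1+r_j)) ≤ (a₂C_FX₁·1 + a₂Φ(1+E′))∕√L + Z(1+E′)` from `Σ qU ≤ 1`, `Σ φ ≤ Φ`, `Σ ζ ≤ Z`,
`r_j ≤ E′`. [cite: Balaban1985RegularSpaces, (1.29) p.81] -/
theorem e_budget_le {N : ℕ} {sL a₂ C_F X₁ E' Z Φ : ℝ} (hsL : 0 < sL) (ha₂ : 0 ≤ a₂) (hCF : 0 ≤ C_F) (hX₁ : 0 ≤ X₁) (hE' : 0 ≤ E')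
    (qU φ ζ r : ℕ → ℝ) (hφ0 : ∀ j, 0 ≤ φ j) (hζ0 : ∀ j, 0 ≤ ζ j) (hr : ∀ j, j ∈ range N → r j ≤ E')
    (hqU : ∑ j ∈ range N, qU j ≤ 1) (hφ : ∑ j ∈ range N, φ j ≤ Φ) (hζ : ∑ j ∈ range N, ζ j ≤ Z) :
    ∑ j ∈ range N, ((a₂ * C_F * X₁ * qU j + a₂ * φ j * (1 + r j)) / sL + ζ j * (1 + r j)) ≤
      (a₂ * C_F * X₁ * 1 + a₂ * Φ * (1 + E')) / sL + Z * (1 + E') := by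
  have hA : ∑ j ∈ range N, (a₂ * C_F * X₁ * qU j + a₂ * φ j * (1 + r j)) ≤ a₂ * C_F * X₁ * 1 + a₂ * Φ * (1 + E') := by
    calc ∑ j ∈ range N, (a₂ * C_F * X₁ * qU j + a₂ * φ j * (1 + r j))
        ≤ ∑ j ∈ range N, (a₂ * C_F * X₁ * qU j + a₂ * φ j * (1 + E')) :=
          Finset.sum_le_sum fun j hj => by
            have hφj : 0 ≤ a₂ * φ j := mul_nonneg ha₂ (hφ0 j)
            nlinarith [hr j hj]
      _ = a₂ * C_F * X₁ * ∑ j ∈ range N, qU j + a₂ * (∑ j ∈ range N, φ j) * (1 + E') := by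
          rw [Finset.sum_add_distrib, Finset.mul_sum, Finset.mul_sum, Finset.sum_mul]
      _ ≤ a₂ * C_F * X₁ * 1 + a₂ * Φ * (1 + E') := by
          have h1 := mul_le_mul_of_nonneg_left hqU (by positivity : 0 ≤ a₂ * C_F * X₁)
          have h2 := mul_le_mul_of_nonneg_right (mul_le_mul_of_nonneg_left hφ ha₂) (by positivity : 0 ≤ 1 + E')
          linarith
  have hB : ∑ j ∈ range N, ζ j * (1 + r j) ≤ Z * (1 + E') := by
    calc ∑ j ∈ range N, ζ j * (1 + r j) ≤ ∑ j ∈ range N, ζ j * (1 + E') :=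
          Finset.sum_le_sum fun j hj => mul_le_mul_of_nonneg_left (by linarith [hr j hj]) (hζ0 j)
      _ = (∑ j ∈ range N, ζ j) * (1 + E') := by rw [Finset.sum_mul]
      _ ≤ Z * (1 + E') := mul_le_mul_of_nonneg_right hζ (by positivity)
  rw [Finset.sum_add_distrib, ← Finset.sum_div]
  exact add_le_add (div_le_div_of_nonneg_right hA hsL.le) hB

/-- The smallness row: `e^E·(k₁·G_d + k₂·G_u + Σ_η) ≤ ½` when the three functionals are `≤ δ` and `e^E·(k₁+k₂+1)·δ ≤ ½`. [cite: Balaban1985RegularSpaces, (1.29) p.81] -/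
theorem smallness_le {E δ k₁ k₂ Gd Gu Sη : ℝ} (hk₁ : 0 ≤ k₁) (hk₂ : 0 ≤ k₂) (hGd : Gd ≤ δ) (hGu : Gu ≤ δ) (hη : Sη ≤ δ)
    (hδκ : Real.exp E * (k₁ + k₂ + 1) * δ ≤ 1 / 2) : Real.exp E * (k₁ * Gd + k₂ * Gu + Sη) ≤ 1 / 2 := by
  have hE := Real.exp_pos E
  nlinarith [mul_le_mul_of_nonneg_left hGd hk₁, mul_le_mul_of_nonneg_left hGu hk₂, mul_nonneg hE.le hk₁, mul_nonneg hE.le hk₂]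


end Summit.QuantumFields.YangMills.Theorems.FluctuationComparisonRegPrIntLS2BetaRelFlapOfFeedersAlgebra

end
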